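import Literature.AlgebraicGeometry.Motives.AbelianVarietyDihedralOrderEightBrauerRelations
import Literature.AlgebraicGeometry.Motives.AbelianVarietyAlternatingFiveBrauerRelation
import HarnessLib

/-!
# The Brauer relation lattice of `A_5` in full: rank `5`, Bartel–Dokchitser's PRIMITIVE relation
# `Θ = S_3 − D_5 − A_4 + A_5` (Theorem A, case (3) with `S = A_5` simple, `d = 1`, `Q = 1`: `Prim(A_5) ≅ ℤ`, "Θ = any
# relation of the form `G + Σ_{H ≠ G} a_H H`"), and `K(A_5) = ℤΘ ⊕ Imprim` with `Imprim` induced from `A_4, V_4, D_5, S_3`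

Layer A1/A2 of the Hodge foundations lane (`lit-hodgefound`, row A1-20⁺ · A2, seat p03 generation 28, row g28-#13) on
the ALGEBRAIC carrier; sequel of `Motives/AbelianVarietyDihedralOrderEightBrauerRelations` (g28-#2; same method;
CONSUMED: `indClassFun_one_apply_eq_div`, `card_conj_mem_bot`, `indClassFun_top_one`,
`mem_ker_linearCombination_indClassFun_one_iff`) and of `Motives/AbelianVarietyAlternatingFiveBrauerRelation` (g25:
the relation `1 + 8A_5 = 4A_4 + 2D_5 + 3C_5` and its Kani–Rosen isogeny; CONSUMED: `mem_zpowers_fiveCycle_iff`,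
`mem_stabilizer_four_iff`, `mem_normalizer_fiveCycle_iff`, `fiveCycle_pow_five`,
`SymmetricGroupPartition.card_alternatingGroup_fin_five`; nothing restated).  Bartel–Dokchitser, Theorem A (3): an
extension `1 → S^d → G → Q → 1` with `S` simple, `Q` quasi-elementary, `Q → Out S^d` injective; for `S ≇ 𝔽_l` the
table gives `Prim(G) ≅ ℤ` if `Q = 1` and "`Θ =` any relation of the form `G + Σ_{H≠G} a_H H`".  The smallest
instance is `A_5` itself (`S = A_5`, `d = 1`, `Q = 1`).  Here on Mathlib's `↥(alternatingGroup (Fin 5))`: the NINE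
classes of subgroups `1, C_2 = ⟨(01)(23)⟩, C_3 = ⟨(012)⟩, V_4 = C((01)(23)), C_5 = ⟨c⟩ (`c = (01234)`),
S_3 = N(⟨(012)⟩), D_5 = N(⟨c⟩), A_4 = Stab(4), A_5`, all nine permutation characters explicit on the four rational
classes (§2; marks by `decide`), the four class equations solved (§3: free coordinates `a_1, a_{C_2}, a_{C_3}, a_{V_4},
a_{S_3}`; **rank `5`** = the non-cyclic classes `V_4, S_3, D_5, A_4, A_5`), and (§4) the ℤ-basis
**`Θ = S_3 − D_5 − A_4 + A_5`** (coefficient of `G` equal to `1` — a generator of `Prim(A_5) ≅ ℤ`; as permutation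
characters `(1_{S_3})^G + 1 = (1_{D_5})^G + (1_{A_4})^G`, Kani–Rosen: `B_{S_3} × B_{A_5} ∼ B_{D_5} × B_{A_4}`),
`Ind Θ_{A_4} = C_2 − C_3 − V_4 + A_4`, `Ind_{V_4} = 1 − 3C_2 + 2V_4`, `Ind_{D_5} = 1 − 2C_2 − C_5 + 2D_5`,
`Ind_{S_3} = 1 − 2C_2 − C_3 + 2S_3`; the imprimitive part `Imprim` (`A_5` is simple: nothing is lifted; the proper
non-cyclic subgroups are `V_4, S_3, D_5, A_4`, with `K(D_{10})`, `K(S_3)`, `K(C_2²)` of rank one and `K(A_4)` of rank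
two (g28-#9)) is the span of these four, on which `a_{A_5} = 0`; **`kΘ ∈ Imprim ↔ k = 0` and `K(A_5) = ℤΘ ⊕ Imprim`:
`Prim(A_5) ≅ ℤ`**, the coefficient of `Θ` in `a ∈ K(A_5)` being exactly `a_{A_5}`.  Everything here is PROVED; NO
definition, NO named fact (net Literature debt 0).

## Sources, verbatim

A. Bartel, T. Dokchitser, *Brauer relations in finite groups*, J. Eur. Math. Soc. **17** (2015) (arXiv 1103.2047, held
`paper:arxiv-1103.2047`).  §1.1 Theorem A (3) (p0003): "`G` is an extension `1 → S^d → G → Q → 1`, where `S` is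
simple, `Q` is quasi-elementary, the natural map `Q → Out S^d` is injective and, moreover, either (a) `S^d` is minimal
among the normal subgroups of `G` […]"; table, case 3 (`S ≇ 𝔽_l`): "`ℤ` if `Q = {1}`, `ℤ/pℤ` if `Q ≠ {1}`";
"`Θ =` any relation of the form `G + Σ_{H≠G} a_H H`".  §2 (p0006): Induction; "the rank of `K(G)` is the number of
conjugacy classes of non-cyclic subgroups"; Examples 2–3.
H. Lange, R. E. Rodríguez, LNM 2310 (2022), §7.1.1 (the subgroups `A_4`, `D_5`, `ℤ/5` of `A_5` up to conjugacy).

## Dictionary and what is proved (namespace `Literature.AlgebraicGeometry.Motives.AbelianVariety`)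

Representatives (indices `0…8`): `![⊥, zpowers d, zpowers t, centralizer {d}, zpowers c, N(zpowers t), N(zpowers c),
Stab(4), ⊤]` with `d = (01)(23) = swap 0 1 * swap 2 3`, `t = (012) = swap 0 1 * swap 1 2`,
`c = (01234) = swap 0 1 * swap 1 2 * swap 2 3 * swap 3 4`; classes described by `g = 1`, `g² = 1`, `g³ = 1`, `g⁵ = 1`
(on the underlying permutation).  `𝒦` any `Submodule ℤ (Fin 9 → ℤ)` with `a ∈ 𝒦 ↔ Σ_i a_i (1_{H_i})^G = 0`.

* §1 `orderOf_doubleTransposition_threeCycle_fiveCycle_altFive`, `mem_centralizer_doubleTransposition_altFive_iff`,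
  **`mem_normalizer_threeCycle_altFive_iff`** (`S_3 = N(⟨(012)⟩)`: `x ∈ N ↔ x t x⁻¹ ∈ ⟨t⟩`), `natCard_subgroups_altFive`.
* §2 `card_conj_mem_*_altFive` (seven marks functions), **`indClassFun_one_apply_altFive`**.
* §3 `pow_eq_one_cases_altFive`, `sum_smul_indClassFun_altFive_apply`, **`sum_smul_indClassFun_altFive_eq_zero_iff`**,
  **`relations_mem_altFive`** (`Θ` and the four induced relations), **`indClassFun_normalizer_threeCycle_add_top_eq_altFive`**.
* §4 `mem_brauerRelationLattice_altFive_iff`, **`eq_combination_of_mem_brauerRelationLattice_altFive`**,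
  **`brauerRelationLattice_altFive_eq_span`**, `linearIndependent_basis_altFive`,
  `ker_linearCombination_indClassFun_one_altFive_eq_span`, **`finrank_ker_linearCombination_indClassFun_one_altFive`** (`= 5`),
  **`smul_thetaPrim_mem_span_imprimitive_altFive_iff`**, **`brauerRelationLattice_altFive_eq_span_thetaPrim_sup_imprimitive`**.

## References

* [BartelDokchitser2015] A. Bartel, T. Dokchitser, *Brauer relations in finite groups*, JEMS 17 (2015), §1.1 Theorem A
  (3) and its table, §2.
* [LangeRodriguez2022] H. Lange, R. E. Rodríguez, *Decomposition of Jacobians by Prym varieties*, LNM 2310, §7.1.1.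
-/

noncomputable section

universe u

open CategoryTheory CategoryTheory.Limits
open Literature.RepresentationTheory.FiniteGroups
open Equiv Equiv.Perm

namespace Literature.AlgebraicGeometry.Motives

namespace AbelianVariety

/-! ## §1 `A_5 = ↥(alternatingGroup (Fin 5))`: `d = (01)(23)`, `t = (012)`, `c = (01234)`; `V_4`, `S_3` -/

section AltFiveLatticeGroup

/-- `|A_5| = 60` (the companion's `SymmetricGroupPartition.card_alternatingGroup_fin_five`). [folklore] -/
private theorem card_altFive : Fintype.card (alternatingGroup (Fin 5)) = 60 :=
  SymmetricGroupPartition.card_alternatingGroup_fin_five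

/-- `d = (01)(23)`, `t = (012)`, `c = (01234)` have orders `2, 3, 5`. [cite: LangeRodriguez2022, §7.1.1] -/
theorem orderOf_doubleTransposition_threeCycle_fiveCycle_altFive :
    orderOf (⟨swap (0 : Fin 5) 1 * swap 2 3, Perm.mem_alternatingGroup.2 (by decide)⟩ : alternatingGroup (Fin 5)) = 2 ∧ orderOf (⟨swap (0 : Fin 5) 1 * swap 1 2, Perm.mem_alternatingGroup.2 (by decide)⟩ : alternatingGroup (Fin 5)) = 3 ∧ orderOf (⟨swap (0 : Fin 5) 1 * swap 1 2 * swap 2 3 * swap 3 4, Perm.mem_alternatingGroup.2 (by decide)⟩ : alternatingGroup (Fin 5)) = 5 := by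
  refine ⟨?_, ?_, ?_⟩
  · rw [orderOf_eq_prime_iff (p := 2)]
    exact ⟨Subtype.ext (by decide), fun h ↦ absurd (congrArg Subtype.val h) (by decide)⟩
  · haveI : Fact (Nat.Prime 3) := ⟨Nat.prime_three⟩
    rw [orderOf_eq_prime_iff (p := 3)]
    exact ⟨Subtype.ext (by decide), fun h ↦ absurd (congrArg Subtype.val h) (by decide)⟩
  · haveI : Fact (Nat.Prime 5) := ⟨by norm_num⟩
    rw [orderOf_eq_prime_iff (p := 5)]
    exact ⟨Subtype.ext (by decide), fun h ↦ absurd (congrArg Subtype.val h) (by decide)⟩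

/-- `y ∈ ⟨g⟩ ↔ y ∈ {g^k : k < orderOf g}`. [folklore] -/
private theorem mem_zpowers_a5_iff (g : alternatingGroup (Fin 5)) {m : ℕ} (hm : orderOf g = m) (y : alternatingGroup (Fin 5)) :
    y ∈ Subgroup.zpowers g ↔ y ∈ (Finset.range m).image (g ^ ·) := by
  rw [mem_zpowers_iff_mem_range_orderOf, hm]

/-- **`y ∈ V_4 = C_{A_5}((01)(23)) ↔ d y = y d`** (`V_4 = {1, (01)(23), (02)(13), (03)(12)}`). [cite: LangeRodriguez2022, §7.1.1] -/
theorem mem_centralizer_doubleTransposition_altFive_iff (y : alternatingGroup (Fin 5)) :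
    y ∈ Subgroup.centralizer ({(⟨swap (0 : Fin 5) 1 * swap 2 3, Perm.mem_alternatingGroup.2 (by decide)⟩ : alternatingGroup (Fin 5))} : Set (alternatingGroup (Fin 5))) ↔ (⟨swap (0 : Fin 5) 1 * swap 2 3, Perm.mem_alternatingGroup.2 (by decide)⟩ : alternatingGroup (Fin 5)) * y = y * (⟨swap (0 : Fin 5) 1 * swap 2 3, Perm.mem_alternatingGroup.2 (by decide)⟩ : alternatingGroup (Fin 5)) := by
  rw [Subgroup.mem_centralizer_iff]
  simp only [Set.mem_singleton_iff, forall_eq]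

/-- **The normaliser of the `3`-cycle `⟨t⟩` in `A_5` (`≅ S_3`)**: `x ∈ N(⟨t⟩) ↔ x t x⁻¹ ∈ ⟨t⟩`, read on
permutations: `↔ ∃ k < 3, tᵏ = x t x⁻¹` (as for the companion's `mem_normalizer_fiveCycle_iff`).
[cite: BartelDokchitser2015, §2 (Example 2: S_3 = C_3 ⋊ C_2)] [cite: LangeRodriguez2022, §7.1.1] -/
theorem mem_normalizer_threeCycle_altFive_iff (x : alternatingGroup (Fin 5)) :
    x ∈ Subgroup.normalizer ((Subgroup.zpowers (⟨swap (0 : Fin 5) 1 * swap 1 2, Perm.mem_alternatingGroup.2 (by decide)⟩ : alternatingGroup (Fin 5))) : Set (alternatingGroup (Fin 5))) ↔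
      ∃ k : Fin 3, (swap (0 : Fin 5) 1 * swap 1 2) ^ (k : ℕ) =
        (x : Perm (Fin 5)) * (swap (0 : Fin 5) 1 * swap 1 2) * (x : Perm (Fin 5))⁻¹ := by
  classical
  set t' : alternatingGroup (Fin 5) := (⟨swap (0 : Fin 5) 1 * swap 1 2, Perm.mem_alternatingGroup.2 (by decide)⟩ : alternatingGroup (Fin 5)) with ht'
  have hord : orderOf t' = 3 := orderOf_doubleTransposition_threeCycle_fiveCycle_altFive.2.1
  have hmem_iff : ∀ y : alternatingGroup (Fin 5), y ∈ Subgroup.zpowers t' ↔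
      ∃ k : Fin 3, (swap (0 : Fin 5) 1 * swap 1 2) ^ (k : ℕ) = (y : Perm (Fin 5)) := by
    intro y
    constructor
    · intro hy
      rw [mem_zpowers_iff_mem_range_orderOf, hord] at hy
      obtain ⟨k, hk, rfl⟩ := Finset.mem_image.1 hy
      exact ⟨⟨k, Finset.mem_range.1 hk⟩, by rw [SubgroupClass.coe_pow]⟩
    · rintro ⟨k, hk⟩
      have h : t' ^ (k : ℕ) = y := Subtype.ext (by rw [SubgroupClass.coe_pow]; exact hk)
      rw [← h]
      exact Subgroup.npow_mem_zpowers t' k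
  have hcoe : ((x * t' * x⁻¹ : alternatingGroup (Fin 5)) : Perm (Fin 5)) =
      (x : Perm (Fin 5)) * (swap (0 : Fin 5) 1 * swap 1 2) * (x : Perm (Fin 5))⁻¹ := by
    rw [Subgroup.coe_mul, Subgroup.coe_mul, Subgroup.coe_inv]
  rw [← hcoe, ← hmem_iff (x * t' * x⁻¹), Subgroup.mem_normalizer_iff]
  constructor
  · intro h
    exact (h t').1 (Subgroup.mem_zpowers t')
  · intro hmem h
    have hprime : (Nat.card (Subgroup.zpowers t')).Prime := by
      rw [Nat.card_zpowers, hord]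
      exact Nat.prime_three
    have hne : x * t' * x⁻¹ ≠ 1 := fun h1 ↦ by
      have : t' = 1 := by
        have e : t' = x⁻¹ * (x * t' * x⁻¹) * x := by group
        rw [e, h1]; group
      exact absurd (congrArg Subtype.val this) (by rw [ht']; decide)
    have heq : Subgroup.zpowers t' = Subgroup.zpowers (x * t' * x⁻¹) := eq_zpowers_of_prime_card hprime hmem hne
    have hconj : ∀ k : ℤ, x * t' ^ k * x⁻¹ = (x * t' * x⁻¹) ^ k := fun k ↦ by
      rw [← MulAut.conj_apply, map_zpow, MulAut.conj_apply]
    constructor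
    · intro hh
      obtain ⟨k, rfl⟩ := Subgroup.mem_zpowers_iff.1 hh
      rw [hconj k, heq]
      exact Subgroup.zpow_mem_zpowers _ k
    · intro hh
      rw [heq] at hh
      obtain ⟨k, hk⟩ := Subgroup.mem_zpowers_iff.1 hh
      rw [← hconj k] at hk
      have : h = t' ^ k := by
        have e : x⁻¹ * (x * t' ^ k * x⁻¹) * x = x⁻¹ * (x * h * x⁻¹) * x := by rw [hk]
        rw [show x⁻¹ * (x * t' ^ k * x⁻¹) * x = t' ^ k by group,
          show x⁻¹ * (x * h * x⁻¹) * x = h by group] at e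
        exact e.symm
      rw [this]
      exact Subgroup.zpow_mem_zpowers t' k

end AltFiveLatticeGroup

/-! ## §2 The marks and the nine permutation characters, machine-checked -/

section AltFiveLatticeMarks

/-- `|{y : Q y}|` as a filter cardinality. [folklore] -/
private theorem natCard_subtype_eq_card_filter_a5 (P : alternatingGroup (Fin 5) → Prop) [DecidablePred P]
    (Q : alternatingGroup (Fin 5) → Prop) (hQP : ∀ y, Q y ↔ P y) :
    Nat.card {y : alternatingGroup (Fin 5) // Q y} = (Finset.univ.filter P).card := by
  rw [← Fintype.card_subtype, ← Nat.card_eq_fintype_card]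
  exact Nat.card_congr (Equiv.subtypeEquivRight hQP)

/-- **Marks of `C_2 = ⟨(01)(23)⟩`**: `60` at `1`, `4` on double transpositions. [cite: BartelDokchitser2015, §2] -/
theorem card_conj_mem_doubleTransposition_altFive (g : alternatingGroup (Fin 5)) :
    Nat.card {y : alternatingGroup (Fin 5) // y⁻¹ * g * y ∈ Subgroup.zpowers (⟨swap (0 : Fin 5) 1 * swap 2 3, Perm.mem_alternatingGroup.2 (by decide)⟩ : alternatingGroup (Fin 5))} =
      if g = 1 then 60 else if (g : Perm (Fin 5)) ^ 2 = 1 then 4 else 0 := by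
  classical
  rw [natCard_subtype_eq_card_filter_a5 _ _ fun y ↦
    mem_zpowers_a5_iff _ orderOf_doubleTransposition_threeCycle_fiveCycle_altFive.1 _]
  revert g
  decide +kernel

/-- **Marks of `C_3 = ⟨(012)⟩`**: `60` at `1`, `6` on `3`-cycles. [cite: BartelDokchitser2015, §2] -/
theorem card_conj_mem_threeCycle_altFive (g : alternatingGroup (Fin 5)) :
    Nat.card {y : alternatingGroup (Fin 5) // y⁻¹ * g * y ∈ Subgroup.zpowers (⟨swap (0 : Fin 5) 1 * swap 1 2, Perm.mem_alternatingGroup.2 (by decide)⟩ : alternatingGroup (Fin 5))} =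
      if g = 1 then 60 else if (g : Perm (Fin 5)) ^ 3 = 1 then 6 else 0 := by
  classical
  rw [natCard_subtype_eq_card_filter_a5 _ _ fun y ↦
    mem_zpowers_a5_iff _ orderOf_doubleTransposition_threeCycle_fiveCycle_altFive.2.1 _]
  revert g
  decide +kernel

/-- **Marks of `V_4 = C((01)(23))`**: `60` at `1`, `12` on double transpositions. [cite: BartelDokchitser2015, §2 (Example 3)] -/
theorem card_conj_mem_centralizer_doubleTransposition_altFive (g : alternatingGroup (Fin 5)) :
    Nat.card {y : alternatingGroup (Fin 5) // y⁻¹ * g * y ∈ Subgroup.centralizer ({(⟨swap (0 : Fin 5) 1 * swap 2 3, Perm.mem_alternatingGroup.2 (by decide)⟩ : alternatingGroup (Fin 5))} : Set (alternatingGroup (Fin 5)))} =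
      if g = 1 then 60 else if (g : Perm (Fin 5)) ^ 2 = 1 then 12 else 0 := by
  classical
  rw [natCard_subtype_eq_card_filter_a5 _ _ fun y ↦ mem_centralizer_doubleTransposition_altFive_iff _]
  revert g
  decide +kernel

/-- **Marks of `C_5 = ⟨c⟩`**: `60` at `1`, `10` on `5`-cycles (both classes). [cite: LangeRodriguez2022, §7.1.1] -/
theorem card_conj_mem_fiveCycle_altFive (g : alternatingGroup (Fin 5)) :
    Nat.card {y : alternatingGroup (Fin 5) // y⁻¹ * g * y ∈ Subgroup.zpowers (⟨swap (0 : Fin 5) 1 * swap 1 2 * swap 2 3 * swap 3 4, Perm.mem_alternatingGroup.2 (by decide)⟩ : alternatingGroup (Fin 5))} =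
      if g = 1 then 60 else if (g : Perm (Fin 5)) ^ 5 = 1 then 10 else 0 := by
  classical
  rw [natCard_subtype_eq_card_filter_a5 _ _ fun y ↦ mem_zpowers_fiveCycle_iff _]
  revert g
  decide +kernel

/-- **Marks of `S_3 = N(⟨(012)⟩)`**: `60` at `1`, `12` on double transpositions, `6` on `3`-cycles. [cite: BartelDokchitser2015, §2 (Example 2)] -/
theorem card_conj_mem_normalizer_threeCycle_altFive (g : alternatingGroup (Fin 5)) :
    Nat.card {y : alternatingGroup (Fin 5) // y⁻¹ * g * y ∈ Subgroup.normalizer ((Subgroup.zpowers (⟨swap (0 : Fin 5) 1 * swap 1 2, Perm.mem_alternatingGroup.2 (by decide)⟩ : alternatingGroup (Fin 5))) : Set (alternatingGroup (Fin 5)))} =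
      if g = 1 then 60 else if (g : Perm (Fin 5)) ^ 2 = 1 then 12 else if (g : Perm (Fin 5)) ^ 3 = 1 then 6 else 0 := by
  classical
  rw [natCard_subtype_eq_card_filter_a5 _ _ fun y ↦ mem_normalizer_threeCycle_altFive_iff _]
  revert g
  decide +kernel

/-- **Marks of `D_5 = N(⟨c⟩)`**: `60` at `1`, `20` on double transpositions, `10` on `5`-cycles. [cite: LangeRodriguez2022, §7.1.1] -/
theorem card_conj_mem_normalizer_fiveCycle_altFive (g : alternatingGroup (Fin 5)) :
    Nat.card {y : alternatingGroup (Fin 5) // y⁻¹ * g * y ∈ Subgroup.normalizer ((Subgroup.zpowers (⟨swap (0 : Fin 5) 1 * swap 1 2 * swap 2 3 * swap 3 4, Perm.mem_alternatingGroup.2 (by decide)⟩ : alternatingGroup (Fin 5))) : Set (alternatingGroup (Fin 5)))} =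
      if g = 1 then 60 else if (g : Perm (Fin 5)) ^ 2 = 1 then 20 else if (g : Perm (Fin 5)) ^ 5 = 1 then 10 else 0 := by
  classical
  rw [natCard_subtype_eq_card_filter_a5 _ _ fun y ↦ mem_normalizer_fiveCycle_iff _]
  revert g
  decide +kernel

/-- **Marks of `A_4 = Stab(4)`**: `60` at `1`, `12` on double transpositions, `24` on `3`-cycles. [cite: LangeRodriguez2022, §7.1.1] -/
theorem card_conj_mem_stabilizer_four_altFive (g : alternatingGroup (Fin 5)) :
    Nat.card {y : alternatingGroup (Fin 5) // y⁻¹ * g * y ∈ MulAction.stabilizer (alternatingGroup (Fin 5)) (4 : Fin 5)} =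
      if g = 1 then 60 else if (g : Perm (Fin 5)) ^ 2 = 1 then 12 else if (g : Perm (Fin 5)) ^ 3 = 1 then 24 else 0 := by
  classical
  rw [natCard_subtype_eq_card_filter_a5 _ _ fun y ↦ mem_stabilizer_four_iff _]
  revert g
  decide +kernel

/-- The orders `2, 3, 4, 5, 6, 10, 12` of `C_2, C_3, V_4, C_5, S_3, D_5, A_4`. [cite: LangeRodriguez2022, §7.1.1] -/
theorem natCard_subgroups_altFive :
    Nat.card (Subgroup.zpowers (⟨swap (0 : Fin 5) 1 * swap 2 3, Perm.mem_alternatingGroup.2 (by decide)⟩ : alternatingGroup (Fin 5))) = 2 ∧ Nat.card (Subgroup.zpowers (⟨swap (0 : Fin 5) 1 * swap 1 2, Perm.mem_alternatingGroup.2 (by decide)⟩ : alternatingGroup (Fin 5))) = 3 ∧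
    Nat.card ↥(Subgroup.centralizer ({(⟨swap (0 : Fin 5) 1 * swap 2 3, Perm.mem_alternatingGroup.2 (by decide)⟩ : alternatingGroup (Fin 5))} : Set (alternatingGroup (Fin 5)))) = 4 ∧ Nat.card (Subgroup.zpowers (⟨swap (0 : Fin 5) 1 * swap 1 2 * swap 2 3 * swap 3 4, Perm.mem_alternatingGroup.2 (by decide)⟩ : alternatingGroup (Fin 5))) = 5 ∧
    Nat.card ↥(Subgroup.normalizer ((Subgroup.zpowers (⟨swap (0 : Fin 5) 1 * swap 1 2, Perm.mem_alternatingGroup.2 (by decide)⟩ : alternatingGroup (Fin 5))) : Set (alternatingGroup (Fin 5)))) = 6 ∧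
    Nat.card ↥(Subgroup.normalizer ((Subgroup.zpowers (⟨swap (0 : Fin 5) 1 * swap 1 2 * swap 2 3 * swap 3 4, Perm.mem_alternatingGroup.2 (by decide)⟩ : alternatingGroup (Fin 5))) : Set (alternatingGroup (Fin 5)))) = 10 ∧
    Nat.card ↥(MulAction.stabilizer (alternatingGroup (Fin 5)) (4 : Fin 5)) = 12 := by
  classical
  obtain ⟨o2, o3, o5⟩ := orderOf_doubleTransposition_threeCycle_fiveCycle_altFive
  refine ⟨?_, ?_, ?_, ?_, ?_, ?_, ?_⟩
  · rw [Nat.card_zpowers, o2]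
  · rw [Nat.card_zpowers, o3]
  · show Nat.card {y : alternatingGroup (Fin 5) // y ∈ Subgroup.centralizer ({(⟨swap (0 : Fin 5) 1 * swap 2 3, Perm.mem_alternatingGroup.2 (by decide)⟩ : alternatingGroup (Fin 5))} : Set (alternatingGroup (Fin 5)))} = 4
    rw [natCard_subtype_eq_card_filter_a5 _ (· ∈ Subgroup.centralizer ({(⟨swap (0 : Fin 5) 1 * swap 2 3, Perm.mem_alternatingGroup.2 (by decide)⟩ : alternatingGroup (Fin 5))} : Set (alternatingGroup (Fin 5))))
      mem_centralizer_doubleTransposition_altFive_iff]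
    decide +kernel
  · rw [Nat.card_zpowers, o5]
  · show Nat.card {y : alternatingGroup (Fin 5) // y ∈ Subgroup.normalizer ((Subgroup.zpowers (⟨swap (0 : Fin 5) 1 * swap 1 2, Perm.mem_alternatingGroup.2 (by decide)⟩ : alternatingGroup (Fin 5))) : Set (alternatingGroup (Fin 5)))} = 6
    rw [natCard_subtype_eq_card_filter_a5 _ (· ∈ Subgroup.normalizer ((Subgroup.zpowers (⟨swap (0 : Fin 5) 1 * swap 1 2, Perm.mem_alternatingGroup.2 (by decide)⟩ : alternatingGroup (Fin 5))) : Set (alternatingGroup (Fin 5))))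
      mem_normalizer_threeCycle_altFive_iff]
    decide +kernel
  · show Nat.card {y : alternatingGroup (Fin 5) // y ∈ Subgroup.normalizer ((Subgroup.zpowers (⟨swap (0 : Fin 5) 1 * swap 1 2 * swap 2 3 * swap 3 4, Perm.mem_alternatingGroup.2 (by decide)⟩ : alternatingGroup (Fin 5))) : Set (alternatingGroup (Fin 5)))} = 10
    rw [natCard_subtype_eq_card_filter_a5 _ (· ∈ Subgroup.normalizer ((Subgroup.zpowers (⟨swap (0 : Fin 5) 1 * swap 1 2 * swap 2 3 * swap 3 4, Perm.mem_alternatingGroup.2 (by decide)⟩ : alternatingGroup (Fin 5))) : Set (alternatingGroup (Fin 5))))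
      mem_normalizer_fiveCycle_iff]
    decide +kernel
  · show Nat.card {y : alternatingGroup (Fin 5) // y ∈ MulAction.stabilizer (alternatingGroup (Fin 5)) (4 : Fin 5)} = 12
    rw [natCard_subtype_eq_card_filter_a5 _ (· ∈ MulAction.stabilizer (alternatingGroup (Fin 5)) (4 : Fin 5)) mem_stabilizer_four_iff]
    decide +kernel

/-- **The nine permutation characters of `A_5` as explicit functions** (values at `1`, double transpositions,
`3`-cycles, `5`-cycles: `60,0,0,0`; `30,2,0,0`; `20,0,2,0`; `15,3,0,0`; `12,0,0,2`; `10,2,1,0`; `6,2,0,1`;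
`5,1,2,0`; `1`). [cite: BartelDokchitser2015, §1.1 ("Θ ∈ K(G) ⟺ Σ_i n_i Ind 1_{H_i} = 0")] -/
theorem indClassFun_one_apply_altFive (g : alternatingGroup (Fin 5)) :
    indClassFun (⊥ : Subgroup (alternatingGroup (Fin 5))) 1 g = (if g = 1 then (60 : ℂ) else 0) ∧
    indClassFun (Subgroup.zpowers (⟨swap (0 : Fin 5) 1 * swap 2 3, Perm.mem_alternatingGroup.2 (by decide)⟩ : alternatingGroup (Fin 5))) 1 g = (if g = 1 then (30 : ℂ) else if (g : Perm (Fin 5)) ^ 2 = 1 then 2 else 0) ∧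
    indClassFun (Subgroup.zpowers (⟨swap (0 : Fin 5) 1 * swap 1 2, Perm.mem_alternatingGroup.2 (by decide)⟩ : alternatingGroup (Fin 5))) 1 g = (if g = 1 then (20 : ℂ) else if (g : Perm (Fin 5)) ^ 3 = 1 then 2 else 0) ∧
    indClassFun (Subgroup.centralizer ({(⟨swap (0 : Fin 5) 1 * swap 2 3, Perm.mem_alternatingGroup.2 (by decide)⟩ : alternatingGroup (Fin 5))} : Set (alternatingGroup (Fin 5)))) 1 g = (if g = 1 then (15 : ℂ) else if (g : Perm (Fin 5)) ^ 2 = 1 then 3 else 0) ∧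
    indClassFun (Subgroup.zpowers (⟨swap (0 : Fin 5) 1 * swap 1 2 * swap 2 3 * swap 3 4, Perm.mem_alternatingGroup.2 (by decide)⟩ : alternatingGroup (Fin 5))) 1 g = (if g = 1 then (12 : ℂ) else if (g : Perm (Fin 5)) ^ 5 = 1 then 2 else 0) ∧
    indClassFun (Subgroup.normalizer ((Subgroup.zpowers (⟨swap (0 : Fin 5) 1 * swap 1 2, Perm.mem_alternatingGroup.2 (by decide)⟩ : alternatingGroup (Fin 5))) : Set (alternatingGroup (Fin 5)))) 1 g = (if g = 1 then (10 : ℂ) else if (g : Perm (Fin 5)) ^ 2 = 1 then 2 else if (g : Perm (Fin 5)) ^ 3 = 1 then 1 else 0) ∧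
    indClassFun (Subgroup.normalizer ((Subgroup.zpowers (⟨swap (0 : Fin 5) 1 * swap 1 2 * swap 2 3 * swap 3 4, Perm.mem_alternatingGroup.2 (by decide)⟩ : alternatingGroup (Fin 5))) : Set (alternatingGroup (Fin 5)))) 1 g = (if g = 1 then (6 : ℂ) else if (g : Perm (Fin 5)) ^ 2 = 1 then 2 else if (g : Perm (Fin 5)) ^ 5 = 1 then 1 else 0) ∧
    indClassFun (MulAction.stabilizer (alternatingGroup (Fin 5)) (4 : Fin 5)) 1 g = (if g = 1 then (5 : ℂ) else if (g : Perm (Fin 5)) ^ 2 = 1 then 1 else if (g : Perm (Fin 5)) ^ 3 = 1 then 2 else 0) ∧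
    indClassFun (⊤ : Subgroup (alternatingGroup (Fin 5))) 1 g = 1 := by
  classical
  obtain ⟨c1, c2, c3, c4, c5, c6, c7⟩ := natCard_subgroups_altFive
  refine ⟨?_, ?_, ?_, ?_, ?_, ?_, ?_, ?_, ?_⟩
  · rw [indClassFun_one_apply_eq_div, card_conj_mem_bot, Subgroup.card_bot, card_altFive]
    split_ifs <;> norm_num
  · rw [indClassFun_one_apply_eq_div, card_conj_mem_doubleTransposition_altFive, c1]
    split_ifs <;> norm_num
  · rw [indClassFun_one_apply_eq_div, card_conj_mem_threeCycle_altFive, c2]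
    split_ifs <;> norm_num
  · rw [indClassFun_one_apply_eq_div, card_conj_mem_centralizer_doubleTransposition_altFive, c3]
    split_ifs <;> norm_num
  · rw [indClassFun_one_apply_eq_div, card_conj_mem_fiveCycle_altFive, c4]
    split_ifs <;> norm_num
  · rw [indClassFun_one_apply_eq_div, card_conj_mem_normalizer_threeCycle_altFive, c5]
    split_ifs <;> norm_num
  · rw [indClassFun_one_apply_eq_div, card_conj_mem_normalizer_fiveCycle_altFive, c6]
    split_ifs <;> norm_num
  · rw [indClassFun_one_apply_eq_div, card_conj_mem_stabilizer_four_altFive, c7]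
    split_ifs <;> norm_num
  · rw [indClassFun_top_one, Pi.one_apply]

end AltFiveLatticeMarks

/-! ## §3 The four class equations; `Θ` and the induced relations -/

section AltFiveLatticeRelations

/-- The rational classes: every `g ∈ A_5` is `1`, or of order `2` (`g² = 1`), `3` (`g³ = 1`) or `5` (`g⁵ = 1`),
exclusively, machine-checked. [cite: LangeRodriguez2022, §7.1.1] -/
theorem pow_eq_one_cases_altFive (g : alternatingGroup (Fin 5)) :
    g = 1 ∨ ((g : Perm (Fin 5)) ^ 2 = 1 ∧ g ≠ 1 ∧ (g : Perm (Fin 5)) ^ 3 ≠ 1 ∧ (g : Perm (Fin 5)) ^ 5 ≠ 1) ∨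
      ((g : Perm (Fin 5)) ^ 3 = 1 ∧ g ≠ 1 ∧ (g : Perm (Fin 5)) ^ 2 ≠ 1 ∧ (g : Perm (Fin 5)) ^ 5 ≠ 1) ∨
      ((g : Perm (Fin 5)) ^ 5 = 1 ∧ g ≠ 1 ∧ (g : Perm (Fin 5)) ^ 2 ≠ 1 ∧ (g : Perm (Fin 5)) ^ 3 ≠ 1) := by
  revert g
  decide +kernel

/-- At `g = 1` all class predicates hold. [folklore] -/
private theorem one_pow_altFive :
    ((1 : alternatingGroup (Fin 5)) : Perm (Fin 5)) ^ 2 = 1 ∧ ((1 : alternatingGroup (Fin 5)) : Perm (Fin 5)) ^ 3 = 1 ∧ ((1 : alternatingGroup (Fin 5)) : Perm (Fin 5)) ^ 5 = 1 := by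
  decide

/-- A nine-term sum of scalar multiples of functions, evaluated at a point. [folklore] -/
private theorem sum_fin_nine_smul_apply_a5 (a : Fin 9 → ℤ) (F : Fin 9 → alternatingGroup (Fin 5) → ℂ) (g : alternatingGroup (Fin 5)) :
    (∑ i : Fin 9, (a i : ℂ) • F i) g = a 0 * F 0 g + a 1 * F 1 g + a 2 * F 2 g + a 3 * F 3 g + a 4 * F 4 g +
      a 5 * F 5 g + a 6 * F 6 g + a 7 * F 7 g + a 8 * F 8 g := by
  simp [Finset.sum_apply, Fin.sum_univ_succ]
  ring

/-- The signed-sum test on the nine representatives, pointwise. [cite: BartelDokchitser2015, §1.1] -/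
theorem sum_smul_indClassFun_altFive_apply (a : Fin 9 → ℤ) (g : alternatingGroup (Fin 5)) :
    (∑ i : Fin 9, (a i : ℂ) • indClassFun ((![⊥,
        Subgroup.zpowers (⟨swap (0 : Fin 5) 1 * swap 2 3, Perm.mem_alternatingGroup.2 (by decide)⟩ : alternatingGroup (Fin 5)),
        Subgroup.zpowers (⟨swap (0 : Fin 5) 1 * swap 1 2, Perm.mem_alternatingGroup.2 (by decide)⟩ : alternatingGroup (Fin 5)),
        Subgroup.centralizer ({(⟨swap (0 : Fin 5) 1 * swap 2 3, Perm.mem_alternatingGroup.2 (by decide)⟩ : alternatingGroup (Fin 5))} : Set (alternatingGroup (Fin 5))),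
        Subgroup.zpowers (⟨swap (0 : Fin 5) 1 * swap 1 2 * swap 2 3 * swap 3 4, Perm.mem_alternatingGroup.2 (by decide)⟩ : alternatingGroup (Fin 5)),
        Subgroup.normalizer ((Subgroup.zpowers (⟨swap (0 : Fin 5) 1 * swap 1 2, Perm.mem_alternatingGroup.2 (by decide)⟩ : alternatingGroup (Fin 5))) : Set (alternatingGroup (Fin 5))),
        Subgroup.normalizer ((Subgroup.zpowers (⟨swap (0 : Fin 5) 1 * swap 1 2 * swap 2 3 * swap 3 4, Perm.mem_alternatingGroup.2 (by decide)⟩ : alternatingGroup (Fin 5))) : Set (alternatingGroup (Fin 5))),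
        MulAction.stabilizer (alternatingGroup (Fin 5)) (4 : Fin 5),
        ⊤] :
        Fin 9 → Subgroup (alternatingGroup (Fin 5))) i) 1) g =
      a 0 * (if g = 1 then (60 : ℂ) else 0) + a 1 * (if g = 1 then (30 : ℂ) else if (g : Perm (Fin 5)) ^ 2 = 1 then 2 else 0) +
        a 2 * (if g = 1 then (20 : ℂ) else if (g : Perm (Fin 5)) ^ 3 = 1 then 2 else 0) + a 3 * (if g = 1 then (15 : ℂ) else if (g : Perm (Fin 5)) ^ 2 = 1 then 3 else 0) +
        a 4 * (if g = 1 then (12 : ℂ) else if (g : Perm (Fin 5)) ^ 5 = 1 then 2 else 0) +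
        a 5 * (if g = 1 then (10 : ℂ) else if (g : Perm (Fin 5)) ^ 2 = 1 then 2 else if (g : Perm (Fin 5)) ^ 3 = 1 then 1 else 0) +
        a 6 * (if g = 1 then (6 : ℂ) else if (g : Perm (Fin 5)) ^ 2 = 1 then 2 else if (g : Perm (Fin 5)) ^ 5 = 1 then 1 else 0) +
        a 7 * (if g = 1 then (5 : ℂ) else if (g : Perm (Fin 5)) ^ 2 = 1 then 1 else if (g : Perm (Fin 5)) ^ 3 = 1 then 2 else 0) + a 8 := by
  obtain ⟨h0, h1, h2, h3, h4, h5, h6, h7, h8⟩ := indClassFun_one_apply_altFive g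
  rw [sum_fin_nine_smul_apply_a5]
  show (a 0 : ℂ) * indClassFun (⊥ : Subgroup (alternatingGroup (Fin 5))) 1 g +
      (a 1 : ℂ) * indClassFun (Subgroup.zpowers (⟨swap (0 : Fin 5) 1 * swap 2 3, Perm.mem_alternatingGroup.2 (by decide)⟩ : alternatingGroup (Fin 5))) 1 g +
      (a 2 : ℂ) * indClassFun (Subgroup.zpowers (⟨swap (0 : Fin 5) 1 * swap 1 2, Perm.mem_alternatingGroup.2 (by decide)⟩ : alternatingGroup (Fin 5))) 1 g +
      (a 3 : ℂ) * indClassFun (Subgroup.centralizer ({(⟨swap (0 : Fin 5) 1 * swap 2 3, Perm.mem_alternatingGroup.2 (by decide)⟩ : alternatingGroup (Fin 5))} : Set (alternatingGroup (Fin 5)))) 1 g +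
      (a 4 : ℂ) * indClassFun (Subgroup.zpowers (⟨swap (0 : Fin 5) 1 * swap 1 2 * swap 2 3 * swap 3 4, Perm.mem_alternatingGroup.2 (by decide)⟩ : alternatingGroup (Fin 5))) 1 g +
      (a 5 : ℂ) * indClassFun (Subgroup.normalizer ((Subgroup.zpowers (⟨swap (0 : Fin 5) 1 * swap 1 2, Perm.mem_alternatingGroup.2 (by decide)⟩ : alternatingGroup (Fin 5))) : Set (alternatingGroup (Fin 5)))) 1 g +
      (a 6 : ℂ) * indClassFun (Subgroup.normalizer ((Subgroup.zpowers (⟨swap (0 : Fin 5) 1 * swap 1 2 * swap 2 3 * swap 3 4, Perm.mem_alternatingGroup.2 (by decide)⟩ : alternatingGroup (Fin 5))) : Set (alternatingGroup (Fin 5)))) 1 g +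
      (a 7 : ℂ) * indClassFun (MulAction.stabilizer (alternatingGroup (Fin 5)) (4 : Fin 5)) 1 g +
      (a 8 : ℂ) * indClassFun (⊤ : Subgroup (alternatingGroup (Fin 5))) 1 g = _
  rw [h0, h1, h2, h3, h4, h5, h6, h7, h8, mul_one]

/-- **The Brauer relations of `A_5`** on `![1, C_2, C_3, V_4, C_5, S_3, D_5, A_4, A_5]`: `a ∈ K(A_5)` iff
`a_{C_5} = −3a_1 − a_{C_2} − a_{C_3}`, `a_{D_5} = −2a_1 − 2a_{C_2} − 2a_{V_4} − a_{S_3}`,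
`a_{A_4} = −4a_1 − 2a_{C_2} − 2a_{C_3} − a_{V_4} − a_{S_3}`, `a_{A_5} = 8a_1 + 4a_{C_2} + 2a_{C_3} + 2a_{V_4} + a_{S_3}`
(free `a_1, a_{C_2}, a_{C_3}, a_{V_4}, a_{S_3}`: rank `5`) — the class equations at `1`, `(01)(23)`, `(012)`, `c` solved.
[cite: BartelDokchitser2015, §1.1; §2 ("the rank of K(G) is the number of conjugacy classes of non-cyclic subgroups")] -/
theorem sum_smul_indClassFun_altFive_eq_zero_iff (a : Fin 9 → ℤ) :
    ∑ i : Fin 9, (a i : ℂ) • indClassFun ((![⊥,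
        Subgroup.zpowers (⟨swap (0 : Fin 5) 1 * swap 2 3, Perm.mem_alternatingGroup.2 (by decide)⟩ : alternatingGroup (Fin 5)),
        Subgroup.zpowers (⟨swap (0 : Fin 5) 1 * swap 1 2, Perm.mem_alternatingGroup.2 (by decide)⟩ : alternatingGroup (Fin 5)),
        Subgroup.centralizer ({(⟨swap (0 : Fin 5) 1 * swap 2 3, Perm.mem_alternatingGroup.2 (by decide)⟩ : alternatingGroup (Fin 5))} : Set (alternatingGroup (Fin 5))),
        Subgroup.zpowers (⟨swap (0 : Fin 5) 1 * swap 1 2 * swap 2 3 * swap 3 4, Perm.mem_alternatingGroup.2 (by decide)⟩ : alternatingGroup (Fin 5)),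
        Subgroup.normalizer ((Subgroup.zpowers (⟨swap (0 : Fin 5) 1 * swap 1 2, Perm.mem_alternatingGroup.2 (by decide)⟩ : alternatingGroup (Fin 5))) : Set (alternatingGroup (Fin 5))),
        Subgroup.normalizer ((Subgroup.zpowers (⟨swap (0 : Fin 5) 1 * swap 1 2 * swap 2 3 * swap 3 4, Perm.mem_alternatingGroup.2 (by decide)⟩ : alternatingGroup (Fin 5))) : Set (alternatingGroup (Fin 5))),
        MulAction.stabilizer (alternatingGroup (Fin 5)) (4 : Fin 5),
        ⊤] :
        Fin 9 → Subgroup (alternatingGroup (Fin 5))) i) 1 = 0 ↔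
      a 4 = -3 * a 0 - a 1 - a 2 ∧ a 6 = -2 * a 0 - 2 * a 1 - 2 * a 3 - a 5 ∧
        a 7 = -4 * a 0 - 2 * a 1 - 2 * a 2 - a 3 - a 5 ∧ a 8 = 8 * a 0 + 4 * a 1 + 2 * a 2 + 2 * a 3 + a 5 := by
  constructor
  · intro h
    have e := fun g ↦ (sum_smul_indClassFun_altFive_apply a g).symm.trans (congr_fun h g)
    have e0 := e 1
    have e1 := e (⟨swap (0 : Fin 5) 1 * swap 2 3, Perm.mem_alternatingGroup.2 (by decide)⟩ : alternatingGroup (Fin 5))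
    have e2 := e (⟨swap (0 : Fin 5) 1 * swap 1 2, Perm.mem_alternatingGroup.2 (by decide)⟩ : alternatingGroup (Fin 5))
    have e3 := e (⟨swap (0 : Fin 5) 1 * swap 1 2 * swap 2 3 * swap 3 4, Perm.mem_alternatingGroup.2 (by decide)⟩ : alternatingGroup (Fin 5))
    simp (config := { decide := true }) only [Pi.zero_apply, if_true, if_false, mul_zero, add_zero] at e0 e1 e2 e3
    have i0 : ((60 * a 0 + 30 * a 1 + 20 * a 2 + 15 * a 3 + 12 * a 4 + 10 * a 5 + 6 * a 6 + 5 * a 7 + a 8 : ℤ) : ℂ) =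
        0 := by
      push_cast; linear_combination e0
    have i1 : ((2 * a 1 + 3 * a 3 + 2 * a 5 + 2 * a 6 + a 7 + a 8 : ℤ) : ℂ) = 0 := by push_cast; linear_combination e1
    have i2 : ((2 * a 2 + a 5 + 2 * a 7 + a 8 : ℤ) : ℂ) = 0 := by push_cast; linear_combination e2
    have i3 : ((2 * a 4 + a 6 + a 8 : ℤ) : ℂ) = 0 := by push_cast; linear_combination e3
    norm_cast at i0 i1 i2 i3
    omega
  · rintro ⟨h4, h6, h7, h8⟩
    funext g
    rw [sum_smul_indClassFun_altFive_apply, Pi.zero_apply, h4, h6, h7, h8]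
    push_cast
    rcases pow_eq_one_cases_altFive g with rfl | ⟨p2, n1, n3, n5⟩ | ⟨p3, n1, n2, n5⟩ | ⟨p5, n1, n2, n3⟩
    · simp only [if_true, if_pos one_pow_altFive.1, if_pos one_pow_altFive.2.1, if_pos one_pow_altFive.2.2]
      ring
    · simp only [if_neg n1, if_pos p2, if_neg n3, if_neg n5]
      ring
    · simp only [if_neg n1, if_neg n2, if_pos p3, if_neg n5]
      ring
    · simp only [if_neg n1, if_neg n2, if_neg n3, if_pos p5]
      ring

/-- **`Θ = S_3 − D_5 − A_4 + A_5` and the four induced relations are relations of `A_5`** (a `Fin 5`-family):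
`0 ↦ Θ` (Theorem A (3): coefficient of `G` equal to `1`), `1 ↦ Ind Θ_{A_4} = C_2 − C_3 − V_4 + A_4`,
`2 ↦ Ind_{V_4} = 1 − 3C_2 + 2V_4`, `3 ↦ Ind_{D_5} = 1 − 2C_2 − C_5 + 2D_5`, `4 ↦ Ind_{S_3} = 1 − 2C_2 − C_3 + 2S_3`.
[cite: BartelDokchitser2015, §1.1 Theorem A (3) (table: "Θ = any relation of the form G + Σ_{H≠G} a_H H"); §2 (Induction, Examples 2–3)] -/
theorem relations_mem_altFive (k : Fin 5) :
    ∑ i : Fin 9, (((![![0, 0, 0, 0, 0, 1, -1, -1, 1],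
      ![0, 1, -1, -1, 0, 0, 0, 1, 0],
      ![1, -3, 0, 2, 0, 0, 0, 0, 0],
      ![1, -2, 0, 0, -1, 0, 2, 0, 0],
      ![1, -2, -1, 0, 0, 2, 0, 0, 0]] : Fin 5 → Fin 9 → ℤ) k i : ℤ) : ℂ) • indClassFun ((![⊥,
        Subgroup.zpowers (⟨swap (0 : Fin 5) 1 * swap 2 3, Perm.mem_alternatingGroup.2 (by decide)⟩ : alternatingGroup (Fin 5)),
        Subgroup.zpowers (⟨swap (0 : Fin 5) 1 * swap 1 2, Perm.mem_alternatingGroup.2 (by decide)⟩ : alternatingGroup (Fin 5)),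
        Subgroup.centralizer ({(⟨swap (0 : Fin 5) 1 * swap 2 3, Perm.mem_alternatingGroup.2 (by decide)⟩ : alternatingGroup (Fin 5))} : Set (alternatingGroup (Fin 5))),
        Subgroup.zpowers (⟨swap (0 : Fin 5) 1 * swap 1 2 * swap 2 3 * swap 3 4, Perm.mem_alternatingGroup.2 (by decide)⟩ : alternatingGroup (Fin 5)),
        Subgroup.normalizer ((Subgroup.zpowers (⟨swap (0 : Fin 5) 1 * swap 1 2, Perm.mem_alternatingGroup.2 (by decide)⟩ : alternatingGroup (Fin 5))) : Set (alternatingGroup (Fin 5))),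
        Subgroup.normalizer ((Subgroup.zpowers (⟨swap (0 : Fin 5) 1 * swap 1 2 * swap 2 3 * swap 3 4, Perm.mem_alternatingGroup.2 (by decide)⟩ : alternatingGroup (Fin 5))) : Set (alternatingGroup (Fin 5))),
        MulAction.stabilizer (alternatingGroup (Fin 5)) (4 : Fin 5),
        ⊤] :
        Fin 9 → Subgroup (alternatingGroup (Fin 5))) i) 1 = 0 := by
  refine (sum_smul_indClassFun_altFive_eq_zero_iff _).2 ?_
  fin_cases k <;> simp

/-- **`(1_{S_3})^G + (1_{A_5})^G = (1_{D_5})^G + (1_{A_4})^G`** — `Θ` as a two-plus-two identity of permutation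
characters (Kani–Rosen: `B_{S_3} × B_{A_5} ∼ B_{D_5} × B_{A_4}`). [cite: BartelDokchitser2015, §1.1 Theorem A (3)] -/
theorem indClassFun_normalizer_threeCycle_add_top_eq_altFive :
    indClassFun (Subgroup.normalizer ((Subgroup.zpowers (⟨swap (0 : Fin 5) 1 * swap 1 2, Perm.mem_alternatingGroup.2 (by decide)⟩ : alternatingGroup (Fin 5))) : Set (alternatingGroup (Fin 5)))) 1 + indClassFun (⊤ : Subgroup (alternatingGroup (Fin 5))) 1 =
      indClassFun (Subgroup.normalizer ((Subgroup.zpowers (⟨swap (0 : Fin 5) 1 * swap 1 2 * swap 2 3 * swap 3 4, Perm.mem_alternatingGroup.2 (by decide)⟩ : alternatingGroup (Fin 5))) : Set (alternatingGroup (Fin 5)))) 1 +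
        indClassFun (MulAction.stabilizer (alternatingGroup (Fin 5)) (4 : Fin 5)) 1 := by
  funext g
  obtain ⟨-, -, -, -, -, h5, h6, h7, h8⟩ := indClassFun_one_apply_altFive g
  simp only [Pi.add_apply]
  rw [h5, h6, h7, h8]
  rcases pow_eq_one_cases_altFive g with rfl | ⟨p2, n1, n3, n5⟩ | ⟨p3, n1, n2, n5⟩ | ⟨p5, n1, n2, n3⟩
  · simp only [if_true]
    norm_num
  · simp only [if_neg n1, if_pos p2]
  · simp only [if_neg n1, if_neg n2, if_pos p3, if_neg n5]
    norm_num
  · simp only [if_neg n1, if_neg n2, if_neg n3, if_pos p5]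
    norm_num

end AltFiveLatticeRelations

/-! ## §4 `K(A_5) = ℤΘ ⊕ Imprim`, rank `5`, `Prim(A_5) ≅ ℤ` -/

section AltFiveLattice

variable (𝒦 : Submodule ℤ (Fin 9 → ℤ))
  (h𝒦 : ∀ a : Fin 9 → ℤ, a ∈ 𝒦 ↔ ∑ i : Fin 9, (a i : ℂ) • indClassFun ((![⊥,
        Subgroup.zpowers (⟨swap (0 : Fin 5) 1 * swap 2 3, Perm.mem_alternatingGroup.2 (by decide)⟩ : alternatingGroup (Fin 5)),
        Subgroup.zpowers (⟨swap (0 : Fin 5) 1 * swap 1 2, Perm.mem_alternatingGroup.2 (by decide)⟩ : alternatingGroup (Fin 5)),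
        Subgroup.centralizer ({(⟨swap (0 : Fin 5) 1 * swap 2 3, Perm.mem_alternatingGroup.2 (by decide)⟩ : alternatingGroup (Fin 5))} : Set (alternatingGroup (Fin 5))),
        Subgroup.zpowers (⟨swap (0 : Fin 5) 1 * swap 1 2 * swap 2 3 * swap 3 4, Perm.mem_alternatingGroup.2 (by decide)⟩ : alternatingGroup (Fin 5)),
        Subgroup.normalizer ((Subgroup.zpowers (⟨swap (0 : Fin 5) 1 * swap 1 2, Perm.mem_alternatingGroup.2 (by decide)⟩ : alternatingGroup (Fin 5))) : Set (alternatingGroup (Fin 5))),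
        Subgroup.normalizer ((Subgroup.zpowers (⟨swap (0 : Fin 5) 1 * swap 1 2 * swap 2 3 * swap 3 4, Perm.mem_alternatingGroup.2 (by decide)⟩ : alternatingGroup (Fin 5))) : Set (alternatingGroup (Fin 5))),
        MulAction.stabilizer (alternatingGroup (Fin 5)) (4 : Fin 5),
        ⊤] :
        Fin 9 → Subgroup (alternatingGroup (Fin 5))) i) 1 = 0)
include h𝒦

/-- **Membership in `K(A_5)` in coordinates.** [cite: BartelDokchitser2015, §1.1; §2] -/
theorem mem_brauerRelationLattice_altFive_iff (a : Fin 9 → ℤ) :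
    a ∈ 𝒦 ↔ a 4 = -3 * a 0 - a 1 - a 2 ∧ a 6 = -2 * a 0 - 2 * a 1 - 2 * a 3 - a 5 ∧
        a 7 = -4 * a 0 - 2 * a 1 - 2 * a 2 - a 3 - a 5 ∧ a 8 = 8 * a 0 + 4 * a 1 + 2 * a 2 + 2 * a 3 + a 5 :=
  (h𝒦 a).trans (sum_smul_indClassFun_altFive_eq_zero_iff a)

/-- The five listed relations lie in `K(A_5)`. [cite: BartelDokchitser2015, §1.1 Theorem A (3); §2] -/
theorem relations_mem_brauerRelationLattice_altFive (k : Fin 5) : (![![0, 0, 0, 0, 0, 1, -1, -1, 1],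
      ![0, 1, -1, -1, 0, 0, 0, 1, 0],
      ![1, -3, 0, 2, 0, 0, 0, 0, 0],
      ![1, -2, 0, 0, -1, 0, 2, 0, 0],
      ![1, -2, -1, 0, 0, 2, 0, 0, 0]] : Fin 5 → Fin 9 → ℤ) k ∈ 𝒦 :=
  (h𝒦 _).2 (relations_mem_altFive k)

/-- **Every relation of `A_5` in the basis `Θ, Ind Θ_{A_4}, Ind_{V_4}, Ind_{D_5}, Ind_{S_3}` — the coefficient of `Θ`
being `a_{A_5}`.** [cite: BartelDokchitser2015, §1.1 Theorem A (3) ("Prim(G) = ℤ if Q = {1}")] -/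
theorem eq_combination_of_mem_brauerRelationLattice_altFive {a : Fin 9 → ℤ} (ha : a ∈ 𝒦) :
    a = a 8 • (![0, 0, 0, 0, 0, 1, -1, -1, 1] : Fin 9 → ℤ) + (4 * a 0 + 2 * a 1 + a 3) • (![0, 1, -1, -1, 0, 0, 0, 1, 0] : Fin 9 → ℤ) +
      (2 * a 0 + a 1 + a 3) • (![1, -3, 0, 2, 0, 0, 0, 0, 0] : Fin 9 → ℤ) + (3 * a 0 + a 1 + a 2) • (![1, -2, 0, 0, -1, 0, 2, 0, 0] : Fin 9 → ℤ) +
      (-4 * a 0 - 2 * a 1 - a 2 - a 3) • (![1, -2, -1, 0, 0, 2, 0, 0, 0] : Fin 9 → ℤ) := by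
  obtain ⟨h4, h6, h7, h8⟩ := (mem_brauerRelationLattice_altFive_iff 𝒦 h𝒦 a).1 ha
  funext i
  fin_cases i <;> simp <;> omega

/-- **`K(A_5) = ℤΘ ⊕ ℤInd Θ_{A_4} ⊕ ℤInd_{V_4} ⊕ ℤInd_{D_5} ⊕ ℤInd_{S_3}`.** [cite: BartelDokchitser2015, §1.1 Theorem A (3); §2] -/
theorem brauerRelationLattice_altFive_eq_span :
    𝒦 = Submodule.span ℤ {(![0, 0, 0, 0, 0, 1, -1, -1, 1] : Fin 9 → ℤ), ![0, 1, -1, -1, 0, 0, 0, 1, 0], ![1, -3, 0, 2, 0, 0, 0, 0, 0], ![1, -2, 0, 0, -1, 0, 2, 0, 0], ![1, -2, -1, 0, 0, 2, 0, 0, 0]} := by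
  refine le_antisymm (fun a ha ↦ ?_) (Submodule.span_le.2 ?_)
  · rw [eq_combination_of_mem_brauerRelationLattice_altFive 𝒦 h𝒦 ha]
    refine Submodule.add_mem _ (Submodule.add_mem _ (Submodule.add_mem _ (Submodule.add_mem _
      (Submodule.smul_mem _ _ (Submodule.subset_span (by simp)))
      (Submodule.smul_mem _ _ (Submodule.subset_span (by simp))))
      (Submodule.smul_mem _ _ (Submodule.subset_span (by simp))))
      (Submodule.smul_mem _ _ (Submodule.subset_span (by simp))))
      (Submodule.smul_mem _ _ (Submodule.subset_span (by simp)))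
  · rintro v (rfl | rfl | rfl | rfl | rfl)
    · exact relations_mem_brauerRelationLattice_altFive 𝒦 h𝒦 0
    · exact relations_mem_brauerRelationLattice_altFive 𝒦 h𝒦 1
    · exact relations_mem_brauerRelationLattice_altFive 𝒦 h𝒦 2
    · exact relations_mem_brauerRelationLattice_altFive 𝒦 h𝒦 3
    · exact relations_mem_brauerRelationLattice_altFive 𝒦 h𝒦 4

omit h𝒦 in
/-- The five basis vectors are linearly independent. [cite: BartelDokchitser2015, §2 ("clearly linearly independent")] -/
theorem linearIndependent_basis_altFive :
    LinearIndependent ℤ (![(![0, 0, 0, 0, 0, 1, -1, -1, 1] : Fin 9 → ℤ), ![0, 1, -1, -1, 0, 0, 0, 1, 0], ![1, -3, 0, 2, 0, 0, 0, 0, 0], ![1, -2, 0, 0, -1, 0, 2, 0, 0], ![1, -2, -1, 0, 0, 2, 0, 0, 0]] : Fin 5 → Fin 9 → ℤ) := by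
  rw [Fintype.linearIndependent_iff]
  intro c hc i
  have e3 := congr_fun hc 3
  have e4 := congr_fun hc 4
  have e5 := congr_fun hc 5
  have e7 := congr_fun hc 7
  have e8 := congr_fun hc 8
  simp [Fin.sum_univ_five] at e3 e4 e5 e7 e8
  fin_cases i <;> simp <;> omega

omit h𝒦 in
/-- The canonical lattice `K(A_5) = ker(a ↦ Σ_i a_i (1_{H_i})^G)` is the span of the five basis vectors.
[cite: BartelDokchitser2015, §1.1 Theorem A (3)] -/
theorem ker_linearCombination_indClassFun_one_altFive_eq_span :
    LinearMap.ker (Fintype.linearCombination ℤ fun i : Fin 9 ↦ indClassFun ((![⊥,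
        Subgroup.zpowers (⟨swap (0 : Fin 5) 1 * swap 2 3, Perm.mem_alternatingGroup.2 (by decide)⟩ : alternatingGroup (Fin 5)),
        Subgroup.zpowers (⟨swap (0 : Fin 5) 1 * swap 1 2, Perm.mem_alternatingGroup.2 (by decide)⟩ : alternatingGroup (Fin 5)),
        Subgroup.centralizer ({(⟨swap (0 : Fin 5) 1 * swap 2 3, Perm.mem_alternatingGroup.2 (by decide)⟩ : alternatingGroup (Fin 5))} : Set (alternatingGroup (Fin 5))),
        Subgroup.zpowers (⟨swap (0 : Fin 5) 1 * swap 1 2 * swap 2 3 * swap 3 4, Perm.mem_alternatingGroup.2 (by decide)⟩ : alternatingGroup (Fin 5)),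
        Subgroup.normalizer ((Subgroup.zpowers (⟨swap (0 : Fin 5) 1 * swap 1 2, Perm.mem_alternatingGroup.2 (by decide)⟩ : alternatingGroup (Fin 5))) : Set (alternatingGroup (Fin 5))),
        Subgroup.normalizer ((Subgroup.zpowers (⟨swap (0 : Fin 5) 1 * swap 1 2 * swap 2 3 * swap 3 4, Perm.mem_alternatingGroup.2 (by decide)⟩ : alternatingGroup (Fin 5))) : Set (alternatingGroup (Fin 5))),
        MulAction.stabilizer (alternatingGroup (Fin 5)) (4 : Fin 5),
        ⊤] :
        Fin 9 → Subgroup (alternatingGroup (Fin 5))) i) 1) =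
      Submodule.span ℤ {(![0, 0, 0, 0, 0, 1, -1, -1, 1] : Fin 9 → ℤ), ![0, 1, -1, -1, 0, 0, 0, 1, 0], ![1, -3, 0, 2, 0, 0, 0, 0, 0], ![1, -2, 0, 0, -1, 0, 2, 0, 0], ![1, -2, -1, 0, 0, 2, 0, 0, 0]} :=
  brauerRelationLattice_altFive_eq_span _ (mem_ker_linearCombination_indClassFun_one_iff _)

omit h𝒦 in
/-- **`rank K(A_5) = 5`** (on the canonical lattice) — the non-cyclic classes `V_4, S_3, D_5, A_4, A_5`. [cite: BartelDokchitser2015, §2] -/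
theorem finrank_ker_linearCombination_indClassFun_one_altFive :
    Module.finrank ℤ (LinearMap.ker (Fintype.linearCombination ℤ fun i : Fin 9 ↦ indClassFun ((![⊥,
        Subgroup.zpowers (⟨swap (0 : Fin 5) 1 * swap 2 3, Perm.mem_alternatingGroup.2 (by decide)⟩ : alternatingGroup (Fin 5)),
        Subgroup.zpowers (⟨swap (0 : Fin 5) 1 * swap 1 2, Perm.mem_alternatingGroup.2 (by decide)⟩ : alternatingGroup (Fin 5)),
        Subgroup.centralizer ({(⟨swap (0 : Fin 5) 1 * swap 2 3, Perm.mem_alternatingGroup.2 (by decide)⟩ : alternatingGroup (Fin 5))} : Set (alternatingGroup (Fin 5))),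
        Subgroup.zpowers (⟨swap (0 : Fin 5) 1 * swap 1 2 * swap 2 3 * swap 3 4, Perm.mem_alternatingGroup.2 (by decide)⟩ : alternatingGroup (Fin 5)),
        Subgroup.normalizer ((Subgroup.zpowers (⟨swap (0 : Fin 5) 1 * swap 1 2, Perm.mem_alternatingGroup.2 (by decide)⟩ : alternatingGroup (Fin 5))) : Set (alternatingGroup (Fin 5))),
        Subgroup.normalizer ((Subgroup.zpowers (⟨swap (0 : Fin 5) 1 * swap 1 2 * swap 2 3 * swap 3 4, Perm.mem_alternatingGroup.2 (by decide)⟩ : alternatingGroup (Fin 5))) : Set (alternatingGroup (Fin 5))),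
        MulAction.stabilizer (alternatingGroup (Fin 5)) (4 : Fin 5),
        ⊤] :
        Fin 9 → Subgroup (alternatingGroup (Fin 5))) i) 1)) = 5 := by
  rw [ker_linearCombination_indClassFun_one_altFive_eq_span]
  have h := linearIndependent_basis_altFive
  rw [show ({(![0, 0, 0, 0, 0, 1, -1, -1, 1] : Fin 9 → ℤ), ![0, 1, -1, -1, 0, 0, 0, 1, 0], ![1, -3, 0, 2, 0, 0, 0, 0, 0], ![1, -2, 0, 0, -1, 0, 2, 0, 0], ![1, -2, -1, 0, 0, 2, 0, 0, 0]} : Set (Fin 9 → ℤ)) =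
      Set.range (![(![0, 0, 0, 0, 0, 1, -1, -1, 1] : Fin 9 → ℤ), ![0, 1, -1, -1, 0, 0, 0, 1, 0], ![1, -3, 0, 2, 0, 0, 0, 0, 0], ![1, -2, 0, 0, -1, 0, 2, 0, 0], ![1, -2, -1, 0, 0, 2, 0, 0, 0]] : Fin 5 → Fin 9 → ℤ) by
    ext v
    simp only [Set.mem_insert_iff, Set.mem_singleton_iff, Set.mem_range]
    constructor
    · rintro (rfl | rfl | rfl | rfl | rfl)
      exacts [⟨0, rfl⟩, ⟨1, rfl⟩, ⟨2, rfl⟩, ⟨3, rfl⟩, ⟨4, rfl⟩]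
    · rintro ⟨i, rfl⟩
      fin_cases i <;> simp]
  rw [finrank_span_eq_card h, Fintype.card_fin]

omit h𝒦 in
/-- **`Prim(A_5) ≅ ℤ`, generated by `Θ`**: on the imprimitive part `Imprim` (the span of the four induced relations)
the coefficient `a_{A_5}` vanishes, so `kΘ ∈ Imprim ↔ k = 0`. [cite: BartelDokchitser2015, §1.1 Theorem A (3) ("ℤ if Q = {1}")] -/
theorem smul_thetaPrim_mem_span_imprimitive_altFive_iff (k : ℤ) :
    k • (![0, 0, 0, 0, 0, 1, -1, -1, 1] : Fin 9 → ℤ) ∈ Submodule.span ℤ {(![0, 1, -1, -1, 0, 0, 0, 1, 0] : Fin 9 → ℤ), ![1, -3, 0, 2, 0, 0, 0, 0, 0], ![1, -2, 0, 0, -1, 0, 2, 0, 0], ![1, -2, -1, 0, 0, 2, 0, 0, 0]} ↔ k = 0 := by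
  constructor
  · intro h
    have key : ∀ v ∈ Submodule.span ℤ {(![0, 1, -1, -1, 0, 0, 0, 1, 0] : Fin 9 → ℤ), ![1, -3, 0, 2, 0, 0, 0, 0, 0], ![1, -2, 0, 0, -1, 0, 2, 0, 0], ![1, -2, -1, 0, 0, 2, 0, 0, 0]}, v 8 = 0 := by
      intro v hv
      refine Submodule.span_induction (p := fun v _ ↦ v 8 = 0) ?_ ?_ ?_ ?_ hv
      · intro w hw
        simp only [Set.mem_insert_iff, Set.mem_singleton_iff] at hw
        rcases hw with rfl | rfl | rfl | rfl <;> decide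
      · simp
      · intro x y _ _ hx hy
        simp only [Pi.add_apply, hx, hy, add_zero]
      · intro c x _ hx
        simp only [Pi.smul_apply, smul_eq_mul, hx, mul_zero]
    have h8 := key _ h
    simpa using h8
  · rintro rfl
    rw [zero_smul]
    exact Submodule.zero_mem _

/-- **`K(A_5) = ℤΘ ⊔ Imprim`.** [cite: BartelDokchitser2015, §1.1 Theorem A (3)] -/
theorem brauerRelationLattice_altFive_eq_span_thetaPrim_sup_imprimitive :
    𝒦 = Submodule.span ℤ {(![0, 0, 0, 0, 0, 1, -1, -1, 1] : Fin 9 → ℤ)} ⊔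
      Submodule.span ℤ {(![0, 1, -1, -1, 0, 0, 0, 1, 0] : Fin 9 → ℤ), ![1, -3, 0, 2, 0, 0, 0, 0, 0], ![1, -2, 0, 0, -1, 0, 2, 0, 0], ![1, -2, -1, 0, 0, 2, 0, 0, 0]} := by
  rw [brauerRelationLattice_altFive_eq_span 𝒦 h𝒦, ← Submodule.span_union, Set.singleton_union]

end AltFiveLattice

end AbelianVariety

end Literature.AlgebraicGeometry.Motives
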